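import Mathlib
import Literature.Analysis.FluidPDE.SelfSimilarEulerProfile
import Summits.NavierStokesRegularity.NavierStokesRegularity.Theorems.EulerZoomLiouvillePowerGaugeEulerLiouvilleSelfSimilarSublinearConfinement
import Summits.NavierStokesRegularity.NavierStokesRegularity.Theorems.EulerZoomLiouvillePowerGaugeEulerLiouvilleSelfSimilarBackwardEscape
import HarnessLib

/-!
# «NO LONG OUTFLOW DIVES», D1: the backward similarity orbit up to its first exit from the outflow mode
# (crux `EulerZoomLiouville.PowerGaugeEulerLiouville` = stmt-NavierStokesRegularity-19832; line `outflow_dive` of ns-idea-11 g7, stub D1)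

Route `EulerZoomLiouville` (NavierStokesRegularity), crux E, LEAD seat ns-typeII-p2 g13 (own brick of this generation, adopting the
files-only line `Cruxes/PowerGaugeEulerLiouville/Lines/outflow_dive.lean` REV3/4 of the W8 ideator ns-idea-11 g7; D2 `OutflowDive.headGain`
and D3 `OutflowDive.vorticityTransport` are width seat ns-ezl-w1 g5's sibling files).  Let `(V, P′)` be a classical self-similar Euler
profile about `0` at the class rate `γ = 1/(2+ρ)`, `0 < ρ` (CIV (3.3)), and `W y = γy + V y` its similarity transport field.

* `OutflowDive.exists_outflowExit` — **D1, VERBATIM the Prop `OutflowDive.Sig.stub_outflowExit` of the line file**: for `c₁ > 0`, a floor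
  `R₁ > 0` and a point `y` with `‖y‖ > R₁` and `c₁‖y‖² ≤ ⟪y, W y⟫` (fast OUTFLOW), there are `σ₁ ≥ 0` and a `C¹` curve `Y` with `Y 0 = y`,
  `Y′ = −W(Y)` on `[0, σ₁]`, staying `c₁`-fast outflow with `R₁ ≤ ‖Y σ‖ ≤ ‖y‖` on `[0, σ₁]`, such that at `σ₁` EITHER the outflow rate is at
  the threshold from above (`⟪Y σ₁, W(Y σ₁)⟫ ≤ c₁‖Y σ₁‖²`) OR the floor is reached (`‖Y σ₁‖ ≤ R₁`).
  Proof: `Y` is the GLOBAL backward orbit of the cut-off field (`Loc.exists_cutoff_local` on `ball 0 (‖y‖+1)`, `C2.Kelvin.hasDerivAt_flow_neg`),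
  which agrees with `−W(Y)` while `‖Y‖ < ‖y‖ + 1`; `σ₁ := sSup {σ ∈ [0, T] | both closed conditions hold on [0, σ]}` with the horizon
  `T = c₁⁻¹ log(‖y‖/R₁) + 1`; the conditions pass to `σ₁` by closedness; the radial decay `‖Y σ‖ ≤ ‖y‖e^{−c₁σ}`
  (`norm_le_mul_exp_neg_of_outflow`, Grönwall `BackwardEscape.mul_exp_le_of_deriv_ge` on `−‖Y‖²`) and `R₁ ≤ ‖Y σ₁‖` force `σ₁ ≤ T − 1`;
  if both conditions were STRICT at `σ₁` they would persist on `[σ₁, σ₁ + δ]` (openness, and the radius is non-increasing there), so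
  `σ₁ + δ` would lie in the set — contradiction with maximality.
* `OutflowDive.norm_le_mul_exp_neg_of_outflow` — the radial decay along a backward `c₁`-outflow arc of any field.

WHAT THIS IS NOT: not NS, not E — a class-free ODE/topology lemma about `C²` profiles (no budgets, no needle data), `--supports` stmt-19832;
the crux is OPEN; NS regularity is NOT proved. [folklore; cf. ConstantinIgnatovaVicol2026Putative §3.4 (3.19)–(3.20)]
-/

noncomputable section

-- flat `Theorems/<Route><Decl>…` files of one crux share the namespace of the crux (tree convention: `Summit.<S>.<S>.…`)
set_option linter.dupNamespace false

open Set Filter Topology Metric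
open scoped RealInnerProductSpace

namespace Summit.NavierStokesRegularity.NavierStokesRegularity.Theorems.PowerGaugeEulerLiouville

open Literature.Analysis Literature.Analysis.FluidPDE

namespace OutflowDive

/-- **Radial decay along a backward outflow arc.**  If `Y′ = (−1)•W(Y)` on `[0, σ₁]` (any field `Vc`) and
`c₁‖Y s‖² ≤ ⟪Y s, W(Y s)⟫` there, then `‖Y s‖ ≤ ‖Y 0‖·e^{−c₁ s}` on `[0, σ₁]`. [folklore] -/
theorem norm_le_mul_exp_neg_of_outflow {γ c₁ σ₁ : ℝ} {Vc : EuclideanSpace ℝ (Fin 3) → EuclideanSpace ℝ (Fin 3)}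
    {Y : ℝ → EuclideanSpace ℝ (Fin 3)}
    (hY : ∀ s ∈ Icc 0 σ₁, HasDerivAt Y ((-1 : ℝ) • selfSimilarTransport γ 0 Vc (Y s)) s)
    (hout : ∀ s ∈ Icc 0 σ₁, c₁ * ‖Y s‖ ^ 2 ≤ ⟪Y s, selfSimilarTransport γ 0 Vc (Y s)⟫) :
    ∀ s ∈ Icc 0 σ₁, ‖Y s‖ ≤ ‖Y 0‖ * Real.exp (-c₁ * s) := by
  intro s hs
  -- `g = −‖Y‖²`, `g' = 2⟪Y, W Y⟫ ≥ 2c₁‖Y‖² = 2(−c₁) g`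
  have hg : ∀ t ∈ Icc 0 σ₁, HasDerivAt (fun t => -(‖Y t‖ ^ 2))
      (-(2 * ⟪Y t, (-1 : ℝ) • selfSimilarTransport γ 0 Vc (Y t)⟫)) t :=
    fun t ht => (hY t ht).norm_sq.neg
  have hg' : ∀ t ∈ Icc 0 σ₁, 2 * (-c₁) * (-(‖Y t‖ ^ 2)) ≤ -(2 * ⟪Y t, (-1 : ℝ) • selfSimilarTransport γ 0 Vc (Y t)⟫) := by
    intro t ht
    rw [inner_smul_right]
    have := hout t ht
    linarith
  have h := BackwardEscape.mul_exp_le_of_deriv_ge (g := fun t => -(‖Y t‖ ^ 2)) hg hg' s hs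
  -- `−‖Y 0‖² e^{−2c₁ s} ≤ −‖Y s‖²`
  have h2 : ‖Y s‖ ^ 2 ≤ (‖Y 0‖ * Real.exp (-c₁ * s)) ^ 2 := by
    have he : Real.exp (2 * (-c₁) * (s - 0)) = Real.exp (-c₁ * s) ^ 2 := by
      rw [← Real.exp_nat_mul]; congr 1; push_cast; ring
    rw [he] at h
    nlinarith [h]
  have hnn : 0 ≤ ‖Y 0‖ * Real.exp (-c₁ * s) := mul_nonneg (norm_nonneg _) (Real.exp_nonneg _)
  exact (pow_le_pow_iff_left₀ (norm_nonneg _) hnn two_ne_zero).1 h2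

/-- **D1 — THE BACKWARD ORBIT UP TO THE FIRST EXIT FROM THE OUTFLOW MODE** (VERBATIM `OutflowDive.Sig.stub_outflowExit` of
`Lines/outflow_dive.lean`): for `ρ ∈ (0, ½]`, a classical profile `(V, P′)` at rate `γ = 1/(2+ρ)`, `c₁ > 0`, a floor `R₁ > 0` and a point
`y`, `‖y‖ > R₁`, with `c₁‖y‖² ≤ ⟪y, W y⟫`, there are `σ₁ ≥ 0` and a `C¹` curve `Y`, `Y 0 = y`, `Y′ = −W(Y)` on `[0, σ₁]`, staying
`c₁`-fast outflow with `R₁ ≤ ‖Y σ‖ ≤ ‖y‖` on `[0, σ₁]`, and at `σ₁` EITHER `⟪Y σ₁, W(Y σ₁)⟫ ≤ c₁‖Y σ₁‖²` OR `‖Y σ₁‖ ≤ R₁`.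
Proof: `Y` = the global backward orbit of the cut-off field (`Loc.exists_cutoff_local` on `ball 0 (‖y‖+1)`,
`C2.Kelvin.hasDerivAt_flow_neg`); `σ₁ := sSup {σ ∈ [0, T] | the two closed conditions hold on [0, σ]}`, `T = c₁⁻¹ log(‖y‖/R₁) + 1`;
the radial decay `‖Y σ‖ ≤ ‖y‖e^{−c₁σ}` forces `σ₁ ≤ T − 1`, and if both conditions were strict at `σ₁` they would persist (continuity; the
radius keeps decreasing), contradicting maximality. [folklore; cf. ConstantinIgnatovaVicol2026Putative §3.4 (3.19)–(3.20)] -/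
theorem exists_outflowExit : ∀ ρ : ℝ, 0 < ρ → ρ ≤ 1 / 2 →
    ∀ (V : EuclideanSpace ℝ (Fin 3) → EuclideanSpace ℝ (Fin 3)) (P' : EuclideanSpace ℝ (Fin 3) → ℝ),
      IsSelfSimilarEulerProfile (1 / (2 + ρ)) 0 V P' →
      ∀ c₁ : ℝ, 0 < c₁ → ∀ R₁ : ℝ, 0 < R₁ → ∀ y : EuclideanSpace ℝ (Fin 3), R₁ < ‖y‖ →
        c₁ * ‖y‖ ^ 2 ≤ inner ℝ y (selfSimilarTransport (1 / (2 + ρ)) 0 V y) →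
          ∃ σ₁ : ℝ, 0 ≤ σ₁ ∧ ∃ Y : ℝ → EuclideanSpace ℝ (Fin 3), Y 0 = y ∧
            (∀ σ ∈ Set.Icc 0 σ₁,
              HasDerivAt Y (-(selfSimilarTransport (1 / (2 + ρ)) 0 V (Y σ))) σ) ∧
            (∀ σ ∈ Set.Icc 0 σ₁, R₁ ≤ ‖Y σ‖ ∧ ‖Y σ‖ ≤ ‖y‖ ∧
              c₁ * ‖Y σ‖ ^ 2 ≤ inner ℝ (Y σ) (selfSimilarTransport (1 / (2 + ρ)) 0 V (Y σ))) ∧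
            (inner ℝ (Y σ₁) (selfSimilarTransport (1 / (2 + ρ)) 0 V (Y σ₁)) ≤ c₁ * ‖Y σ₁‖ ^ 2 ∨
              ‖Y σ₁‖ ≤ R₁) := by
  intro ρ _hρ _hρh V P' hprof c₁ hc₁ R₁ hR₁ y hy hout0
  set γ : ℝ := 1 / (2 + ρ) with hγdef
  have hU2 : ContDiff ℝ 2 V := hprof.contDiff_velocity
  have hypos : 0 < ‖y‖ := lt_trans hR₁ hy
  -- the cut-off field, equal to `V` on `ball 0 (‖y‖ + 1)`
  obtain ⟨Vc, hVc, -, -, ⟨K, hK⟩, hagree⟩ := Loc.exists_cutoff_local hU2 (R := ‖y‖ + 1) (by linarith)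
  have hVc1 : ContDiff ℝ 1 Vc := hVc.of_le (by norm_num)
  have hWeq : ∀ z : EuclideanSpace ℝ (Fin 3), ‖z‖ < ‖y‖ + 1 →
      selfSimilarTransport γ 0 Vc z = selfSimilarTransport γ 0 V z := by
    intro z hz
    simp only [selfSimilarTransport_apply, hagree z (by rwa [mem_ball, dist_zero_right])]
  -- the global backward orbit of the cut-off field
  set Φ := ODE.evolutionMap (fun _ : ℝ => selfSimilarTransport γ 0 Vc) 0 with hΦ
  set Y : ℝ → EuclideanSpace ℝ (Fin 3) := fun t => Φ (-t) y with hYdef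
  have hYc : ∀ t, HasDerivAt Y ((-1 : ℝ) • selfSimilarTransport γ 0 Vc (Y t)) t :=
    fun t => C2.Kelvin.hasDerivAt_flow_neg (γ := γ) hVc1 hK y t
  have hYcont : Continuous Y := continuous_iff_continuousAt.2 fun t => (hYc t).continuousAt
  have hY0 : Y 0 = y := by simp [hYdef, hΦ, ODE.evolutionMap_self]
  -- continuity of the observables
  have hWc : Continuous (selfSimilarTransport γ 0 V) :=
    (Kelvin.contDiff_selfSimilarTransport (γ := γ) hU2).continuous
  have hnormc : Continuous fun s => ‖Y s‖ := hYcont.norm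
  have hradc : Continuous fun s => ⟪Y s, selfSimilarTransport γ 0 V (Y s)⟫ :=
    Continuous.inner hYcont (hWc.comp hYcont)
  -- the closed two-condition predicate and the open strict one
  set F : Set ℝ := {s | R₁ ≤ ‖Y s‖ ∧ ‖Y s‖ ≤ ‖y‖ ∧ c₁ * ‖Y s‖ ^ 2 ≤ ⟪Y s, selfSimilarTransport γ 0 V (Y s)⟫} with hFdef
  have hFclosed : IsClosed F := by
    rw [hFdef, setOf_and, setOf_and]
    refine (isClosed_le continuous_const hnormc).inter ((isClosed_le hnormc continuous_const).inter ?_)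
    exact isClosed_le ((hnormc.pow 2).const_mul c₁) hradc
  have hF0 : (0 : ℝ) ∈ F := by
    refine ⟨?_, ?_, ?_⟩
    · rw [hY0]; exact hy.le
    · rw [hY0]
    · rw [hY0]; exact hout0
  -- the time horizon `T` and the set `S`
  set T : ℝ := 1 / c₁ * Real.log (‖y‖ / R₁) + 1 with hTdef
  have hlogpos : 0 < Real.log (‖y‖ / R₁) := Real.log_pos ((one_lt_div hR₁).2 hy)
  have hTpos : 0 < T := by positivity
  set S : Set ℝ := {σ | 0 ≤ σ ∧ σ ≤ T ∧ ∀ s ∈ Icc 0 σ, s ∈ F} with hSdef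
  have hS0 : (0 : ℝ) ∈ S := by
    refine ⟨le_rfl, hTpos.le, fun s hs => ?_⟩
    have : s = 0 := le_antisymm hs.2 hs.1
    rw [this]; exact hF0
  have hSne : S.Nonempty := ⟨0, hS0⟩
  have hSbdd : BddAbove S := ⟨T, fun σ hσ => hσ.2.1⟩
  set σ₁ : ℝ := sSup S with hσ₁def
  have hσ₁0 : 0 ≤ σ₁ := le_csSup hSbdd hS0
  have hσ₁T : σ₁ ≤ T := csSup_le hSne fun σ hσ => hσ.2.1
  -- the closed conditions hold on `[0, σ₁)` …
  have hFlt : ∀ s, 0 ≤ s → s < σ₁ → s ∈ F := by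
    intro s hs0 hs
    obtain ⟨σ, hσS, hsσ⟩ := exists_lt_of_lt_csSup hSne hs
    exact hσS.2.2 s ⟨hs0, hsσ.le⟩
  -- … hence on `[0, σ₁]` (closedness)
  have hFσ₁ : ∀ s ∈ Icc 0 σ₁, s ∈ F := by
    intro s hs
    rcases hs.2.lt_or_eq with hlt | heq
    · exact hFlt s hs.1 hlt
    · rw [heq]
      rcases hσ₁0.lt_or_eq with hpos | hzero
      · have hsub : Ico 0 σ₁ ⊆ F := fun t ht => hFlt t ht.1 ht.2
        have hcl : closure (Ico 0 σ₁) ⊆ F := hFclosed.closure_subset_iff.2 hsub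
        apply hcl
        rw [closure_Ico hpos.ne]
        exact right_mem_Icc.2 hσ₁0
      · rw [← hzero]; exact hF0
  -- on `[0, σ₁]` the orbit stays in `ball 0 (‖y‖+1)`, so it is an orbit of `W_V`
  have hYV : ∀ σ ∈ Icc 0 σ₁, HasDerivAt Y (-(selfSimilarTransport γ 0 V (Y σ))) σ := by
    intro σ hσ
    have h := hYc σ
    rw [neg_one_smul, hWeq (Y σ) (by linarith [(hFσ₁ σ hσ).2.1])] at h
    exact h
  -- radial decay on `[0, σ₁]`: `‖Y s‖ ≤ ‖y‖ e^{−c₁ s}`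
  have hdecay : ∀ s ∈ Icc 0 σ₁, ‖Y s‖ ≤ ‖y‖ * Real.exp (-c₁ * s) := by
    have houtc : ∀ s ∈ Icc 0 σ₁, c₁ * ‖Y s‖ ^ 2 ≤ ⟪Y s, selfSimilarTransport γ 0 Vc (Y s)⟫ := by
      intro s hs
      rw [hWeq (Y s) (by linarith [(hFσ₁ s hs).2.1])]
      exact (hFσ₁ s hs).2.2
    have h := norm_le_mul_exp_neg_of_outflow (fun s hs => hYc s) houtc
    intro s hs
    rw [← hY0]
    exact h s hs
  -- hence `σ₁ ≤ T − 1 < T`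
  have hσ₁lt : σ₁ < T := by
    have hmem : σ₁ ∈ Icc 0 σ₁ := right_mem_Icc.2 hσ₁0
    have h1 : R₁ ≤ ‖Y σ₁‖ := (hFσ₁ σ₁ hmem).1
    have h2 : ‖Y σ₁‖ ≤ ‖y‖ * Real.exp (-c₁ * σ₁) := hdecay σ₁ hmem
    have h3 : R₁ ≤ ‖y‖ * Real.exp (-c₁ * σ₁) := h1.trans h2
    -- `e^{c₁ σ₁} ≤ ‖y‖ / R₁`
    have h4 : Real.exp (c₁ * σ₁) ≤ ‖y‖ / R₁ := by
      rw [le_div_iff₀ hR₁]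
      have : Real.exp (c₁ * σ₁) * (‖y‖ * Real.exp (-c₁ * σ₁)) = ‖y‖ := by
        rw [mul_comm, mul_assoc, ← Real.exp_add]; simp
      calc Real.exp (c₁ * σ₁) * R₁ ≤ Real.exp (c₁ * σ₁) * (‖y‖ * Real.exp (-c₁ * σ₁)) :=
            mul_le_mul_of_nonneg_left h3 (Real.exp_nonneg _)
        _ = ‖y‖ := this
    have h5 : c₁ * σ₁ ≤ Real.log (‖y‖ / R₁) := by
      rw [← Real.log_exp (c₁ * σ₁)]
      exact Real.log_le_log (Real.exp_pos _) h4
    have h6 : σ₁ ≤ 1 / c₁ * Real.log (‖y‖ / R₁) := by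
      rw [one_div_mul_eq_div, le_div_iff₀ hc₁]
      linarith
    linarith
  -- the exit alternative at `σ₁`
  refine ⟨σ₁, hσ₁0, Y, hY0, hYV, fun σ hσ => hFσ₁ σ hσ, ?_⟩
  by_contra hnot
  push Not at hnot
  obtain ⟨hstrict, hfloor⟩ := hnot
  -- the open set where both strict conditions (and the cut-off agreement) hold
  set O : Set ℝ := {s | ‖Y s‖ < ‖y‖ + 1 ∧ c₁ * ‖Y s‖ ^ 2 < ⟪Y s, selfSimilarTransport γ 0 V (Y s)⟫ ∧ R₁ < ‖Y s‖}
    with hOdef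
  have hOopen : IsOpen O := by
    rw [hOdef, setOf_and, setOf_and]
    refine (isOpen_lt hnormc continuous_const).inter ((isOpen_lt ((hnormc.pow 2).const_mul c₁) hradc).inter ?_)
    exact isOpen_lt continuous_const hnormc
  have hσ₁O : σ₁ ∈ O := by
    refine ⟨?_, hstrict, hfloor⟩
    linarith [(hFσ₁ σ₁ (right_mem_Icc.2 hσ₁0)).2.1]
  obtain ⟨ε, hε, hball⟩ := Metric.isOpen_iff.1 hOopen σ₁ hσ₁O
  -- a short step `δ` beyond `σ₁`, inside the horizon and inside `O`
  set δ : ℝ := min (ε / 2) ((T - σ₁) / 2) with hδdef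
  have hδpos : 0 < δ := lt_min (by linarith) (by linarith)
  have hδε : δ ≤ ε / 2 := min_le_left _ _
  have hδT : σ₁ + δ ≤ T := by
    have : δ ≤ (T - σ₁) / 2 := min_le_right _ _
    linarith
  have hIccO : Icc σ₁ (σ₁ + δ) ⊆ O := by
    intro s hs
    apply hball
    rw [mem_ball, Real.dist_eq, abs_lt]
    constructor <;> linarith [hs.1, hs.2]
  -- on `[σ₁, σ₁ + δ]` the radius is non-increasing
  have hanti : AntitoneOn (fun s => ‖Y s‖ ^ 2) (Icc σ₁ (σ₁ + δ)) := by
    have hder : ∀ s, HasDerivAt (fun s => ‖Y s‖ ^ 2) (2 * ⟪Y s, (-1 : ℝ) • selfSimilarTransport γ 0 Vc (Y s)⟫) s :=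
      fun s => (hYc s).norm_sq
    have hcont : ContinuousOn (fun s => ‖Y s‖ ^ 2) (Icc σ₁ (σ₁ + δ)) :=
      fun s _ => (hder s).continuousAt.continuousWithinAt
    have hdiff : DifferentiableOn ℝ (fun s => ‖Y s‖ ^ 2) (interior (Icc σ₁ (σ₁ + δ))) :=
      fun s _ => (hder s).differentiableAt.differentiableWithinAt
    refine antitoneOn_of_deriv_nonpos (convex_Icc _ _) hcont hdiff fun s hs => ?_
    rw [interior_Icc] at hs
    have hsO : s ∈ O := hIccO (Ioo_subset_Icc_self hs)
    rw [(hder s).deriv, inner_smul_right, hWeq (Y s) hsO.1]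
    have : 0 ≤ ⟪Y s, selfSimilarTransport γ 0 V (Y s)⟫ := le_trans (by positivity) hsO.2.1.le
    linarith
  -- hence every `s ∈ [0, σ₁ + δ]` lies in `F`
  have hFext : ∀ s ∈ Icc 0 (σ₁ + δ), s ∈ F := by
    intro s hs
    rcases le_or_gt s σ₁ with hle | hgt
    · exact hFσ₁ s ⟨hs.1, hle⟩
    · have hsI : s ∈ Icc σ₁ (σ₁ + δ) := ⟨hgt.le, hs.2⟩
      have hsO : s ∈ O := hIccO hsI
      have hsq : ‖Y s‖ ^ 2 ≤ ‖Y σ₁‖ ^ 2 := hanti (left_mem_Icc.2 (by linarith)) hsI hgt.le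
      have hYσ₁ : ‖Y σ₁‖ ≤ ‖y‖ := (hFσ₁ σ₁ (right_mem_Icc.2 hσ₁0)).2.1
      refine ⟨hsO.2.2.le, ?_, hsO.2.1.le⟩
      have : ‖Y s‖ ≤ ‖Y σ₁‖ := (pow_le_pow_iff_left₀ (norm_nonneg _) (norm_nonneg _) two_ne_zero).1 hsq
      exact this.trans hYσ₁
  -- so `σ₁ + δ ∈ S`, contradicting maximality
  have hmemS : σ₁ + δ ∈ S := ⟨by linarith, hδT, hFext⟩
  have : σ₁ + δ ≤ σ₁ := le_csSup hSbdd hmemS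
  linarith

end OutflowDive

end Summit.NavierStokesRegularity.NavierStokesRegularity.Theorems.PowerGaugeEulerLiouville

end
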